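import Literature.NumberTheory.Li1992.SchwartzPairingFactorisation
import Literature.NumberTheory.Automorphic.AdelicTensorStripping
import Literature.NumberTheory.Automorphic.AdicCompletionCompact
import Mathlib.Analysis.Distribution.SchwartzSpace.Basic
import HarnessLib

/-!
# `L²` facts for FACTORIZABLE Schwartz–Bruhat functions on `𝔸_F^ι`: the `L²`-mass of a pure tensor, the archimedean pairing

[Li1992, Thm 2.1 (27) p. 184] factorises the pairing `⟨φ, φ'⟩` of factorizable `φ = ⊗ φ_v` place by place; [Weil1964, Chap. I n° 11]:
`𝒮(X_A) ⊂ L²(X_A)`.  Topic `NumberTheory/Li1992`; namespace `Literature.NumberTheory.Li1992`.  KERNEL file (theorems only, Mathlib +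
the tree's `piSchwartzBruhatEquiv` ∕ `piAdeleSplit` ∕ `indicatorSB`), companion of `SchwartzPairingFactorisation` (`schwartzPairing_tmul_tmul`)
in the `∫⁻ ‖·‖ₑ²` currency of the letter's unitarity hypothesis `hiso`:

* `lintegral_enorm_sq_tmul` — **`∫ |Φ_∞ ⊗ Φ_f|² dν_X = c_X · ∫ |Φ_∞|² dμ_∞ · ∫ |Φ_f|² dμ_f`** for `ν_X = c_X · split_*(μ_∞ ⊗ μ_f)` (Tonelli);
* `lintegral_enorm_sq_indicatorSB` — `∫ |𝟙_L|² dμ_f = μ_f(L)` for a compact open subgroup `L ≤ (𝔸_F^∞)^ι`;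
* `norm_archPairing_le` — Cauchy–Schwarz for the archimedean pairing `|∫ Φ_∞ \overline{Ψ_∞} dμ_∞| ≤ ‖Φ_∞‖₂ ‖Ψ_∞‖₂` (Mathlib's
  `SchwartzMap.toLp`); `norm_toLp_eq_of_lintegral_eq` — equal `∫ |·|²` ⇒ equal `L²`-norms;
* the Borel structure of `(F ⊗ ℝ)^ι` is taken as an instance BINDER `[BorelSpace (ι → mixedSpace F)]` (it is Mathlib's `Pi.borelSpace`; the
  instance search through `mixedSpace F = (… → ℝ) × (… → ℂ)` exceeds the default budget, so callers supply it).

Used by the E-2 desk of crux H413 (`StubSW2` (ii): the archimedean Weil operators are `L²`-isometries, read off from the global `hiso`).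

## References
* [Li1992] J.-S. Li, J. reine angew. Math. 428 (1992), Thm 2.1 (27) p. 184.
* [Weil1964] A. Weil, Acta Math. 111 (1964), Chap. I n° 11, n° 13.
-/

set_option autoImplicit false

noncomputable section

open _root_.MeasureTheory NumberField NumberField.mixedEmbedding IsDedekindDomain
open scoped ComplexConjugate TensorProduct SchwartzMap NNReal ENNReal Classical InnerProductSpace
open Literature.NumberTheory.Automorphic

namespace Literature.NumberTheory.Li1992

section PureTensor

variable (F : Type) [Field F] [NumberField F] (ι : Type) [Fintype ι] [BorelSpace (ι → mixedSpace F)]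
  [MeasurableSpace (AdeleRing (𝓞 F) F)] [BorelSpace (AdeleRing (𝓞 F) F)]
  [MeasurableSpace (FiniteAdeleRing (𝓞 F) F)] [BorelSpace (FiniteAdeleRing (𝓞 F) F)]
  {νX : Measure (ι → AdeleRing (𝓞 F) F)} {μE : Measure (ι → mixedSpace F)}
  {μf : Measure (ι → FiniteAdeleRing (𝓞 F) F)} {cX : ℝ≥0}

/-- **`∫ |Φ_∞ ⊗ Φ_f|² dν_X = c_X · ∫ |Φ_∞|² dμ_∞ · ∫ |Φ_f|² dμ_f`** for `ν_X = c_X · split_*(μ_∞ ⊗ μ_f)` (Tonelli on the product): the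
`L²`-mass of a factorizable vector factorises. [cite: Li1992, Thm 2.1 (27) p. 184] [cite: Weil1964, Chap. I n° 11] -/
theorem lintegral_enorm_sq_tmul [SFinite μE] [SFinite μf] (hν : νX = cX • (μE.prod μf).map (piAdeleSplit F ι))
    (Φinf : 𝓢((ι → mixedSpace F), ℂ)) (Φfin : FinSB F ι) :
    ∫⁻ x, ‖((piSchwartzBruhatEquiv F ι (Φinf ⊗ₜ Φfin) : piSchwartzBruhat F ι) : (ι → AdeleRing (𝓞 F) F) → ℂ) x‖ₑ ^ 2 ∂νX =
      cX * ((∫⁻ u, ‖Φinf u‖ₑ ^ 2 ∂μE) * ∫⁻ y, ‖(Φfin : (ι → FiniteAdeleRing (𝓞 F) F) → ℂ) y‖ₑ ^ 2 ∂μf) := by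
  haveI := secondCountableTopology_adeleRing F
  haveI := secondCountableTopology_finiteAdeleRing F
  haveI : BorelSpace (ι → AdeleRing (𝓞 F) F) := Pi.borelSpace
  haveI : BorelSpace (ι → FiniteAdeleRing (𝓞 F) F) := Pi.borelSpace
  haveI : BorelSpace ((ι → mixedSpace F) × (ι → FiniteAdeleRing (𝓞 F) F)) := Prod.borelSpace
  rw [coe_piSchwartzBruhatEquiv_tmul, hν,
    show ((cX • (μE.prod μf).map (piAdeleSplit F ι) : Measure (ι → AdeleRing (𝓞 F) F))) =
      (cX : ℝ≥0∞) • (μE.prod μf).map (piAdeleSplit F ι) from rfl,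
    lintegral_smul_measure,
    show (⇑(piAdeleSplit F ι) : _ → ι → AdeleRing (𝓞 F) F) = ⇑(piAdeleSplit F ι).toHomeomorph.toMeasurableEquiv by
      rw [Homeomorph.toMeasurableEquiv_coe]; rfl,
    lintegral_map_equiv]
  congr 1
  have hcoe : ∀ p : (ι → mixedSpace F) × (ι → FiniteAdeleRing (𝓞 F) F),
      (piAdeleSplit F ι).toHomeomorph.toMeasurableEquiv p = piAdeleSplit F ι p := fun p => by
    rw [Homeomorph.toMeasurableEquiv_coe]; rfl
  have h1 : ∀ p : (ι → mixedSpace F) × (ι → FiniteAdeleRing (𝓞 F) F),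
      ‖Φinf (piArch F ι ((piAdeleSplit F ι).toHomeomorph.toMeasurableEquiv p)) *
          (Φfin : (ι → FiniteAdeleRing (𝓞 F) F) → ℂ) (piFinite F ι ((piAdeleSplit F ι).toHomeomorph.toMeasurableEquiv p))‖ₑ ^ 2 =
        ‖Φinf p.1‖ₑ ^ 2 * ‖(Φfin : (ι → FiniteAdeleRing (𝓞 F) F) → ℂ) p.2‖ₑ ^ 2 := fun p => by
    rw [hcoe, piArch_piAdeleSplit, piFinite_piAdeleSplit, enorm_mul, mul_pow]
  simp_rw [h1]
  exact lintegral_prod_mul ((Φinf.continuous.measurable.comp_aemeasurable aemeasurable_id).enorm.pow_const 2)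
    ((Φfin.2.1.continuous.measurable.comp_aemeasurable aemeasurable_id).enorm.pow_const 2)

omit [BorelSpace (ι → mixedSpace F)] [MeasurableSpace (AdeleRing (𝓞 F) F)] [BorelSpace (AdeleRing (𝓞 F) F)] in
/-- `∫ |𝟙_L|² dμ_f = μ_f(L)`: the `L²`-mass of the standard finite test vector. [cite: Weil1964, Chap. I n° 11] -/
theorem lintegral_enorm_sq_indicatorSB (L : AddSubgroup (ι → FiniteAdeleRing (𝓞 F) F))
    (hLo : IsOpen (L : Set (ι → FiniteAdeleRing (𝓞 F) F))) (hLc : IsCompact (L : Set (ι → FiniteAdeleRing (𝓞 F) F))) :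
    ∫⁻ y, ‖(indicatorSB F ι L hLo hLc : (ι → FiniteAdeleRing (𝓞 F) F) → ℂ) y‖ₑ ^ 2 ∂μf = μf L := by
  haveI := secondCountableTopology_finiteAdeleRing F
  haveI : BorelSpace (ι → FiniteAdeleRing (𝓞 F) F) := Pi.borelSpace
  have h : ∀ y, ‖(indicatorSB F ι L hLo hLc : (ι → FiniteAdeleRing (𝓞 F) F) → ℂ) y‖ₑ ^ 2 =
      (L : Set (ι → FiniteAdeleRing (𝓞 F) F)).indicator (fun _ => (1 : ℝ≥0∞)) y := fun y => by
    rw [coe_indicatorSB]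
    by_cases hy : y ∈ (L : Set (ι → FiniteAdeleRing (𝓞 F) F))
    · rw [Set.indicator_of_mem hy, Set.indicator_of_mem hy, enorm_one, one_pow]
    · rw [Set.indicator_of_notMem hy, Set.indicator_of_notMem hy, enorm_zero, zero_pow two_ne_zero]
  simp_rw [h]
  rw [lintegral_indicator_const hLo.measurableSet, one_mul]

omit [NumberField F] [Fintype ι] [BorelSpace (ι → mixedSpace F)] [MeasurableSpace (AdeleRing (𝓞 F) F)]
  [BorelSpace (AdeleRing (𝓞 F) F)] [MeasurableSpace (FiniteAdeleRing (𝓞 F) F)] [BorelSpace (FiniteAdeleRing (𝓞 F) F)] in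
/-- `‖Φ_∞‖_{ℒ²(μ_∞)} = (∫ |Φ_∞|² dμ_∞)^{1/2}`. [folklore] -/
private theorem eLpNorm_two_eq (Φ : (ι → mixedSpace F) → ℂ) :
    eLpNorm Φ 2 μE = (∫⁻ u, ‖Φ u‖ₑ ^ 2 ∂μE) ^ (1 / 2 : ℝ) := by
  rw [eLpNorm_eq_lintegral_rpow_enorm_toReal two_ne_zero ENNReal.ofNat_ne_top, ENNReal.toReal_ofNat]
  congr 1
  refine lintegral_congr fun x => ?_
  rw [← ENNReal.rpow_natCast]
  norm_num

omit [MeasurableSpace (AdeleRing (𝓞 F) F)] [BorelSpace (AdeleRing (𝓞 F) F)] [MeasurableSpace (FiniteAdeleRing (𝓞 F) F)]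
  [BorelSpace (FiniteAdeleRing (𝓞 F) F)] in
/-- **Cauchy–Schwarz for the archimedean pairing**: `|∫ Φ_∞ \overline{Ψ_∞} dμ_∞| ≤ ‖Φ_∞‖₂ ‖Ψ_∞‖₂` (the pairing is the `L²(μ_∞)` inner
product of the classes `[Ψ_∞], [Φ_∞]`; `𝒮 ⊂ L²`). [cite: Weil1964, Chap. I n° 11] -/
theorem norm_archPairing_le [μE.HasTemperateGrowth] (Φ Ψ : 𝓢((ι → mixedSpace F), ℂ)) :
    ‖∫ u, Φ u * conj (Ψ u) ∂μE‖ ≤ ‖Φ.toLp 2 μE‖ * ‖Ψ.toLp 2 μE‖ := by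
  have h : ∫ u, Φ u * conj (Ψ u) ∂μE = ⟪(Ψ.toLp 2 μE : Lp ℂ 2 μE), (Φ.toLp 2 μE : Lp ℂ 2 μE)⟫_ℂ := by
    rw [MeasureTheory.L2.inner_def]
    refine integral_congr_ae ?_
    filter_upwards [Φ.coeFn_toLp 2 μE, Ψ.coeFn_toLp 2 μE] with u h₁ h₂
    rw [h₁, h₂, RCLike.inner_apply, mul_comm]
  rw [h, mul_comm]
  exact norm_inner_le_norm _ _

omit [MeasurableSpace (AdeleRing (𝓞 F) F)] [BorelSpace (AdeleRing (𝓞 F) F)] [MeasurableSpace (FiniteAdeleRing (𝓞 F) F)]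
  [BorelSpace (FiniteAdeleRing (𝓞 F) F)] in
/-- two Schwartz functions with the same `∫ |·|² dμ_∞` have `L²`-classes of the same norm. [cite: Weil1964, Chap. I n° 13] -/
theorem norm_toLp_eq_of_lintegral_eq [μE.HasTemperateGrowth] {Φ Ψ : 𝓢((ι → mixedSpace F), ℂ)}
    (h : ∫⁻ u, ‖Φ u‖ₑ ^ 2 ∂μE = ∫⁻ u, ‖Ψ u‖ₑ ^ 2 ∂μE) : ‖Φ.toLp 2 μE‖ = ‖Ψ.toLp 2 μE‖ := by
  rw [SchwartzMap.norm_toLp, SchwartzMap.norm_toLp, eLpNorm_two_eq, eLpNorm_two_eq, h]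

end PureTensor

end Literature.NumberTheory.Li1992

end
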